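import Literature.NumberTheory.Rogawski1990.CohomologicalFinComponentIsTheta        -- ★ statement vocabulary of the REL-ENGINE stubs (`rhoAtLine`, `locF`, frames)
import Summits.HodgeConjecture.CorCM.B01.Transposition.Item6OmegaChiSplitting      -- ★ `isCompatible_chiSplittingLine` (statement)
import Literature.NumberTheory.Rogawski1990.CohDiscreteMemXiFamilyArchPinned        -- ★ D6 `MemXiFamily` currency of the statement (as in the REL-ENGINE prewrite)
import Summits.HodgeConjecture.HodgeConjecture.Theorems.F0P2iGRDSplit              -- ★ p817998: `wReading_det_eq_localCharOfCenter`; pulls ★ p817128 `F0P2iXvSplitModel`, ★ p816908 `F0P2iGRDSplitTransport`, ★ p803803 `F0P2cOmegaLocalType`, ★ `F0P2cStubCI`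
import Summits.HodgeConjecture.HodgeConjecture.Theorems.F0P3XiLocalLabelsOfMemXiFamily  -- ★ `bc_localComponent_eq_of_mem_cmSplitPacket_members`; pulls ★ `F0P3FinRepConstituentsExist`, ★ D6
import Literature.NumberTheory.Rogawski1990.OneDimAutRepHSplitRigidity             -- ★ `OneDimAutRepH.ext_of_exists_bc_localComponent_eq_of_split`
import Literature.NumberTheory.Automorphic.IrreducibleClassesConstituentsIsotypic   -- ★ `IrrClass.IsConstituentOf.of_isotypicComponent_eq_top_comp`
import HarnessLib

/-!
# Crux `H413`, programme P2 — REL-ENGINE stub **FAM-TR** («family transfer») PROVED in-house: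
# `stubRelFamTransfer_holds : ‹F0P2E3RelEngine.StubRelFamilyTransfer›` (statement BY PASTE, token for token; no `Lines` import)

Cell hodgecm-mathlib (D-0151), FLOOR 0, crux item H413 = stmt-HodgeConjecture-24833, route of record `HCCMUnconditional` (no route verbs);
programme P2 (theta ∕ `hdictE`), desk F0P2-plan (g12) sub-line «REL-ENGINE» (prewrite `F0/P2/F0_P2E3RelEngine.prewrite.F0P2-plan-g12.lean`
36fa610d5283b423; REL ⟸ S2♯ ⊕ FAM-TR ⊕ REL♯ ⊕ CUSP-DICT), brief P2-D2 «FAM-TR in-house» (PLAN-P2.v12 §3).  Author F0P2-p01 (g10).  THEOREMS ONLY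
(no `def`, no instance, no notation, no named fact, no `sorry`); `--supports stmt-HodgeConjecture-24833 --as helper`; never imports a `Cruxes/…/Lines`
module (ref1 O50-1) — the stub's statement is PASTED (prewrite :218–261) and the Lines fold is textual:
`theorem stub_relFamTransfer : StubRelFamilyTransfer := F0P2rFamTransferHolds.stubRelFamTransfer_holds`.

HONEST LABEL (D-0151): «HC_CM is proved only modulo the printed citations until rung 0 closes» — this file closes NO print letter; it
discharges the in-house plumbing row FAM-TR of the REL-ENGINE line without any letter-class hypothesis.

## THE STATEMENT (FAM-TR)
For the CM frame data `(L, ι, H, T, hT)` of the crux, a theta frame `(e₁, dV, g, ιV)` (`ιV k = g_f⁻¹ k g_f`), two automorphic measures and two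
discrete automorphic `P`, `P′` of `U(H)`, Rogawski's auxiliary unitary `μω` and two one-dimensional automorphic `ξ, ξ′` of `H = U(2) × U(1)`:
if `P` lies in the ξ-local family and `P′` in the ξ′-local family (★ D6 `MemXiFamily`), and `P_f ↩ ω_H(μ, a, χ)`, `P′_f ↩ ω_H(μ, a′, χ)`
(★ `HasFinComponent` of Liu's carriers ★ `rhoAtLine … ιV a χ` at the `μ`-attached splittings) for ONE `(μ, χ)`, then `P′` lies in the
ξ-local family.  [Rogawski1990, §13.3 p. 201: a packet is determined by its split members; Thm. 13.3.5 p. 236 «`Π` is unique».]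

## THE PROOF (all ★, no letter, no isotypy of `P.finRep`, no line-class transport (C′), no D1, no D7αᵀ)
`ξ = ξ′` (then `subst`), by the torus rigidity ★ `OneDimAutRepH.ext_of_exists_bc_localComponent_eq_of_split` [Rogawski1990, §12.2 pp. 173–174;
weak approximation]: at a finite place `v` of `L⁺` SPLIT in `L`, at D6's definite witness `w = splitWitness v hs`, ONE class of `U(H)(L⁺_v)` lies in
both singleton split packets `cmSplitPacket … ξ … w` and `cmSplitPacket … ξ′ … w`, whence equal labels `η̃_w, ψ̃_w` (★
`F0P3XiLocalLabelsOfMemXiFamily.bc_localComponent_eq_of_mem_cmSplitPacket_members`, [Zelevinsky1980, Thm. 4.2]).  The class: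
1. **local type of `ω_H(a)` on `U(H)(L⁺_v)`, UNCONDITIONAL** — ★ `F0P2cOmegaLocalType.isLocalTypeAt_rhoAtLine_chi`: `ω_H(a) ∘ inclPlace v` is
   isotypic of the IRREDUCIBLE type `τ_a := X_v(μ, a, χ) ∘ localLineInl ∘ κ_v⁻¹` (Liu's local theta type [Liu2021, Def. 4.11; App. D Lem. D.1 (1)],
   Lem. D.1 (1) per place being ★ `F0P2cStubCI.lemD1_1AsPrinted_chi`); `ω_H(a)` is irreducible and admissible (★ `F0P2cStubCI.rhoAtLine_chi_isIrreducible`,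
   ★ `….rhoAtLine_chi_isAdmissible`), so `ω_H(a) ∘ inclPlace v` HAS a constituent `c₀ = ⟦r⟧` (★ `F0P3FinRepConstituentsExist.exists_isConstituentOf_comp_inclPlace`),
   and `r.ρ ≃ τ_a` (★ `IrrClass.IsConstituentOf.of_isotypicComponent_eq_top_comp`, ★ `….nonempty_equiv_of_isIrreducible`); likewise `c₀′ = ⟦r′⟧`, `r′.ρ ≃ τ_{a′}`.
2. **the split model does not see the line** — ★ p817128 `F0P2iXvSplitModel.areIsomorphicRep_chiCoinv_chiLocalSplittingsD_split` + ★ p816908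
   `F0P2iGRDSplitTransport.nonempty_equiv_comp_localLineInl_localCongr_symm`: `τ_a ≃ Ind_{Q_{2,1}}^{GL₃(L_w)}((θ_w ∘ det) ⊠ χ′_w θ_w^{1-3}) ∘ localPiSplitEquiv H ≃ τ_{a′}`
   (`θ = toHeckeCharacter μ`, `χ′_w` the `w`-reading of `χ`, ★ `F0P2iGRDSplit.wReading_det_eq_localCharOfCenter`) [Liu2021, App. D, proof of Lem. D.1 ¶1 p. 126;
   Rogawski1990, Lemma 4.13.1 (b)]; hence `c₀ = c₀′` (★ `IrrClass.mk_eq_mk_of_equiv`).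
3. **push into `P`, `P′`** along the injective intertwiners of `hfin`, `hfin′` (★ `F0P3FinRepConstituentsExist.isConstituentOf_finRepSmooth_comp_of_hasFinComponent`,
   ★ `IrrClass.comap_comap_symm`): the class `comap (localPiEquiv v)⁻¹ c₀` is a local constituent of `P` AND of `P′` in D6's (b2′) currency, so it lies in
   `Pv v = cmSplitPacket … ξ … w` and in `Pv′ v = cmSplitPacket … ξ′ … w` (★ `LocalConstituentsIn`, ★ `IsXiLocalFamily.eq_cmSplitPacket`).

## References
* [Rogawski1990] J. Rogawski, *Automorphic Representations of Unitary Groups in Three Variables*, Ann. of Math. Stud. 123 (1990): §4.13 p. 62 and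
  Lemma 4.13.1 (b); §12.2 pp. 173–174; §13.1 p. 199; §13.3 p. 201, Thm. 13.3.5 (p. 236 «`Π` is unique»); §14.6 p. 246.
  [corpus:book:rogawski1990-automorphic-representation-unitary-groups-three-variables]
* [Liu2021] Y. Liu, *Fourier–Jacobi cycles and arithmetic relative trace formula*, Camb. J. Math. 9 (2021) = arXiv:2102.11518: Def. 4.11 (l. 2090–2096),
  App. D §D.1, Lem. D.1 (1), proof of Lem. D.1 ¶1 (p. 126).  [corpus:paper:arxiv-2102.11518]
* [Zelevinsky1980] A. Zelevinsky, Ann. Sci. ÉNS 13 (1980), Thm. 4.2, Thm. 6.1.  [BernsteinZelevinsky1977] Thm. 2.9.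
* [GelbartRogawski1991] S. Gelbart, J. Rogawski, Invent. Math. 105 (1991), §3.1 Prop. 3.1.1, (5.1.1), Lem. 5.1.2 p. 466.
* [Flath1979] D. Flath, PSPM 33.1 (1979), §2 Ex. 2, Thm. 3.  [BushnellHenniart2006] §1.1–§2.
-/

set_option autoImplicit false
-- the mandated namespace has the single-problem summit's repeated segment (`HodgeConjecture.HodgeConjecture`)
set_option linter.dupNamespace false

noncomputable section

open scoped Matrix Kronecker MatrixGroups MonoidAlgebra ComplexOrder
open NumberField NumberField.InfinitePlace IsDedekindDomain MeasureTheory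
open Literature.NumberTheory Literature.NumberTheory.Automorphic Literature.NumberTheory.Automorphic.UnitaryGroup
open Literature.NumberTheory.Automorphic.UnitaryGroup.CotangentForms
open Literature.NumberTheory.Automorphic.Liu2021 Literature.NumberTheory.Automorphic.Liu2021.AppendixC
open Literature.NumberTheory.Automorphic.Liu2021.Def411WeilCarriers
open Literature.NumberTheory.Automorphic.Liu2021.Def411WeilCarriersDoubling
open Literature.NumberTheory.Automorphic.IdeleClassGroup
open Literature.NumberTheory.GelbartRogawski1991 Literature.NumberTheory.GelbartRogawski1991.UnitaryDualPair
open Literature.NumberTheory.GelbartRogawski1991.UnitaryDualPair.WeilCoinv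
open Literature.NumberTheory.GelbartRogawski1991.UnitaryDualPair.LocalSplitting
open Literature.RepresentationTheory Literature.RepresentationTheory.Liu2021
open Literature.NumberTheory.GaloisRepresentations Literature.RepresentationTheory.HarrisKudlaSweet1996
open Literature.NumberTheory.Rogawski1990
open Summit.HodgeConjecture.CorCM
open Summit.HodgeConjecture.CorCM.Transposition
open Summit.HodgeConjecture.HodgeConjecture.Cruxes.H413

namespace Summit.HodgeConjecture.HodgeConjecture.Cruxes.H413.F0P2rFamTransferHolds

/-! ## §0 Bookkeeping: constituents of an isotypic representation -/

/-- **A constituent of a representation `ρ` isotypic of a simple type `σ` is a constituent of `σ`** — ★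
`IrrClass.IsConstituentOf.of_isotypicComponent_eq_top_comp` at `e := id` (`ρ ∘ id = ρ`, `σ ∘ id = σ`). [cite: BourbakiAlgebreVIII2012, VIII §4 n°2]
[cite: BushnellHenniart2006, §2] -/
theorem isConstituentOf_of_isotypicComponent_eq_top {G : Type*} [Group G] [TopologicalSpace G] {V W : Type*} [AddCommGroup V]
    [Module ℂ V] [AddCommGroup W] [Module ℂ W] {ρ : Representation ℂ G V} {σ : Representation ℂ G W}
    [IsSimpleModule (MonoidAlgebra ℂ G) σ.asModule]
    (htop : isotypicComponent (MonoidAlgebra ℂ G) ρ.asModule σ.asModule = ⊤) {c : IrrClass G} (h : c.IsConstituentOf ρ) :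
    c.IsConstituentOf σ := by
  have h' : c.IsConstituentOf (ρ.comp (MonoidHom.id G)) := by rwa [MonoidHom.comp_id]
  have h'' := h'.of_isotypicComponent_eq_top_comp htop (MonoidHom.id G)
  rwa [MonoidHom.comp_id] at h''

/-! ## §1 FAM-TR -/

set_option synthInstance.maxHeartbeats 400000 in
set_option maxHeartbeats 16000000 in
/-- **FAM-TR — FAMILY TRANSFER (the REL-ENGINE stub `stub_relFamTransfer`, statement `StubRelFamilyTransfer` token for token).**  If `P` lies in the
ξ-local family and `P′` in the ξ′-local family (★ D6 `MemXiFamily`, ONE auxiliary `μω`), and `P_f ↩ ω_H(μ, a, χ)`, `P′_f ↩ ω_H(μ, a′, χ)` for ONE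
`(μ, χ)` (★ `HasFinComponent` of ★ `rhoAtLine … ιV a χ` ∕ `… a′ χ`), then `P′` lies in the ξ-local family — indeed `ξ′ = ξ`: at every place `v`
of `L⁺` split in `L` the local types of `ω_H(μ, a, χ)` and `ω_H(μ, a′, χ)` on `U(H)(L⁺_v)` are the SAME irreducible principal series (the split model
of Liu's local theta type is line-free), a constituent of it is a local constituent of both `P` and `P′`, hence lies in both singleton split
packets, whose labels therefore agree; automorphic characters of the torus agreeing at all split places are equal.
[cite: Rogawski1990, §4.13 p. 62, Lemma 4.13.1 (b); §12.2 pp. 173–174; §13.1 p. 199; §13.3 p. 201, Thm. 13.3.5] [cite: Liu2021, Def. 4.11 (l. 2090–2096);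
App. D Lem. D.1 (1), proof of Lem. D.1 ¶1 p. 126] [cite: Zelevinsky1980, Thm. 4.2 and Thm. 6.1] [cite: GelbartRogawski1991, §3.1 Prop. 3.1.1; Lem. 5.1.2 p. 466]
[cite: Flath1979, Thm. 3] -/
theorem stubRelFamTransfer_holds :
  ∀ (L : Type) [Field L] [NumberField L] [IsCMField L] (ι : L →+* ℂ) (H : Matrix (Fin 3) (Fin 3) L) (T : GL (Fin 3) ℂ)
    (hT : (T : Matrix (Fin 3) (Fin 3) ℂ)ᴴ * H.map ι * (T : Matrix (Fin 3) (Fin 3) ℂ) = Literature.Geometry.ComplexHyperbolic.BallModel.J),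
    ∀ {n' : ℕ} (e₁ : Fin 3 × Fin 1 ≃ Fin n') (dV : Fin 3 → L) (hdV : ∀ i, IsCMField.complexConj L (dV i) = dV i)
      (hdV0 : ∀ i, dV i ≠ 0) (g : GL (Fin 3) L)
      (hg : ((g : Matrix (Fin 3) (Fin 3) L).map (cmConjRingHom L))ᵀ * H * (g : Matrix (Fin 3) (Fin 3) L) = Matrix.diagonal dV)
      (ιV : finAdelic (↥(maximalRealSubfield L)) L (IsCMField.complexConj L) 3 H →*
          finAdelic (↥(maximalRealSubfield L)) L (IsCMField.complexConj L) 3 (Matrix.diagonal dV)),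
        (∀ k, ((ιV k : finAdelic (↥(maximalRealSubfield L)) L (IsCMField.complexConj L) 3 (Matrix.diagonal dV)) :
            GL (Fin 3) (FiniteAdeleRing (𝓞 L) L)) =
          (toFinAdeleGL L 3 g)⁻¹ * (k : GL (Fin 3) (FiniteAdeleRing (𝓞 L) L)) * toFinAdeleGL L 3 g) →
        ∀ (μA : Measure (adelicGroupData (↥(maximalRealSubfield L)) L (IsCMField.complexConj L) 3 H).automorphicQuotient)
          [(adelicGroupData (↥(maximalRealSubfield L)) L (IsCMField.complexConj L) 3 H).IsAutomorphicMeasure μA]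
          (μA' : Measure (adelicGroupData (↥(maximalRealSubfield L)) L (IsCMField.complexConj L) 3 H).automorphicQuotient)
          [(adelicGroupData (↥(maximalRealSubfield L)) L (IsCMField.complexConj L) 3 H).IsAutomorphicMeasure μA']
          (P : DiscreteAutomorphicRep (adelicGroupData (↥(maximalRealSubfield L)) L (IsCMField.complexConj L) 3 H) μA)
          (P' : DiscreteAutomorphicRep (adelicGroupData (↥(maximalRealSubfield L)) L (IsCMField.complexConj L) 3 H) μA'),
          ∀ (μω : HeckeCharacter L) (hμu : μω.IsUnitary),
            (∀ x : Literature.NumberTheory.GaloisRepresentations.ideleGroup ↥(maximalRealSubfield L),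
              μω (AdeleRing.ideleBaseChange (↥(maximalRealSubfield L)) L x) = quadraticHeckeCharCM L x) →
          ∀ (ξ ξ' : OneDimAutRepH L),
            MemXiFamily P (transpose_map_cmConjRingHom_eq_of_frame L ι H T hT) (isUnit_det_of_frame L ι H T hT) μω hμu ξ →
            MemXiFamily P' (transpose_map_cmConjRingHom_eq_of_frame L ι H T hT) (isUnit_det_of_frame L ι H T hT) μω hμu ξ' →
            ∀ (μ : Literature.NumberTheory.Automorphic.IdeleClassGroup L →ₜ* Circle) (hμ : IsConjugateSymplectic L μ), HasWeight L μ 1 →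
              ∀ (a a' : (↥(maximalRealSubfield L))ˣ) (χ : Chi (↥(maximalRealSubfield L)) L (IsCMField.complexConj L)),
                P.HasFinComponent
                  (rhoAtLine (↥(maximalRealSubfield L)) L (IsCMField.complexConj L) 3 e₁ (Matrix.diagonal dV)
                    (complexConj_imagUnit L) (imagUnit_ne_zero L) (imagUnit_mul_self L) (realDiagonal_isSymm L dV hdV)
                    (isUnit_det_realDiagonal L dV hdV hdV0) (realDiagonal_map L dV hdV).symm
                    (fun a => isCompatible_chiSplittingLine L e₁ dV hdV hdV0 (toHeckeCharacter L μ)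
                      (isUnitary_toHeckeCharacter L μ) ((isOscillatorChar_toHeckeCharacter_iff μ).mpr hμ)
                      (TW (↥(maximalRealSubfield L)) a) (isSymm_TW (↥(maximalRealSubfield L)) a)
                      (isUnit_det_TW (↥(maximalRealSubfield L)) a) (JW (↥(maximalRealSubfield L)) L a)
                      (JW_eq (↥(maximalRealSubfield L)) L a)) ιV a χ) →
                P'.HasFinComponent
                  (rhoAtLine (↥(maximalRealSubfield L)) L (IsCMField.complexConj L) 3 e₁ (Matrix.diagonal dV)
                    (complexConj_imagUnit L) (imagUnit_ne_zero L) (imagUnit_mul_self L) (realDiagonal_isSymm L dV hdV)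
                    (isUnit_det_realDiagonal L dV hdV hdV0) (realDiagonal_map L dV hdV).symm
                    (fun a => isCompatible_chiSplittingLine L e₁ dV hdV hdV0 (toHeckeCharacter L μ)
                      (isUnitary_toHeckeCharacter L μ) ((isOscillatorChar_toHeckeCharacter_iff μ).mpr hμ)
                      (TW (↥(maximalRealSubfield L)) a) (isSymm_TW (↥(maximalRealSubfield L)) a)
                      (isUnit_det_TW (↥(maximalRealSubfield L)) a) (JW (↥(maximalRealSubfield L)) L a)
                      (JW_eq (↥(maximalRealSubfield L)) L a)) ιV a' χ) →
                  MemXiFamily P' (transpose_map_cmConjRingHom_eq_of_frame L ι H T hT) (isUnit_det_of_frame L ι H T hT) μω hμu ξ := by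
  intro L _ _ _ ι H T hT n' e₁ dV hdV hdV0 g hg ιV hιV μA _ μA' _ P P' μω hμu _hquad ξ ξ' hmem hmem' μ hμ _hw a a' χ hfin hfin'
  -- the frame is `3 × 1`
  obtain rfl : n' = 3 := by
    have h := Fintype.card_congr e₁
    simp only [Fintype.card_prod, Fintype.card_fin] at h
    omega
  have hH : (H.map (cmConjRingHom L))ᵀ = H := Literature.NumberTheory.Rogawski1990.transpose_map_cmConjRingHom_eq_of_frame L ι H T hT
  have hHd : IsUnit H.det := Literature.NumberTheory.Rogawski1990.isUnit_det_of_frame L ι H T hT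
  -- `ξ = ξ′`, from the split places
  obtain rfl : ξ = ξ' := by
    refine OneDimAutRepH.ext_of_exists_bc_localComponent_eq_of_split fun v hs => ⟨splitWitness v hs, ?_⟩
    -- frame side conditions at `w = splitWitness v hs`
    have hc1 : IsCMField.complexConj L ≠ 1 := IsCMField.complexConj_ne_one L
    have hHh : (H.map (IsCMField.complexConj L))ᵀ = H := (UnitaryGroup.map_cmConjRingHom_eq_map_complexConj L H) ▸ hH
    have hHw : IsUnit (placeForm H (splitWitness v hs).1) := UnitaryGroup.isUnit_placeForm_of_isUnit_det hHd (splitWitness v hs).1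
    have hJh := reindex_kronecker_JW_hermitian (↥(maximalRealSubfield L)) L (IsCMField.complexConj L) 3 e₁ (Matrix.diagonal dV)
      (realDiagonal_isSymm L dV hdV) (realDiagonal_map L dV hdV).symm a
    have hJh' := reindex_kronecker_JW_hermitian (↥(maximalRealSubfield L)) L (IsCMField.complexConj L) 3 e₁ (Matrix.diagonal dV)
      (realDiagonal_isSymm L dV hdV) (realDiagonal_map L dV hdV).symm a'
    have hJw : IsUnit (placeForm (Matrix.reindex e₁ e₁ (Matrix.diagonal dV ⊗ₖ JW (↥(maximalRealSubfield L)) L a)) (splitWitness v hs).1) :=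
      UnitaryGroup.isUnit_placeForm_of_isUnit_det
        (isUnit_iff_ne_zero.2 (det_reindex_kronecker_JW_ne_zero (↥(maximalRealSubfield L)) L 3 e₁ (Matrix.diagonal dV)
          (isUnit_det_realDiagonal L dV hdV hdV0) (realDiagonal_map L dV hdV).symm a)) (splitWitness v hs).1
    have hJw' : IsUnit (placeForm (Matrix.reindex e₁ e₁ (Matrix.diagonal dV ⊗ₖ JW (↥(maximalRealSubfield L)) L a')) (splitWitness v hs).1) :=
      UnitaryGroup.isUnit_placeForm_of_isUnit_det
        (isUnit_iff_ne_zero.2 (det_reindex_kronecker_JW_ne_zero (↥(maximalRealSubfield L)) L 3 e₁ (Matrix.diagonal dV)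
          (isUnit_det_realDiagonal L dV hdV hdV0) (realDiagonal_map L dV hdV).symm a')) (splitWitness v hs).1
    have hχu := Def411WeilCarriers.norm_chi_eq_one_cm L χ
    -- (2) the split model of Liu's local theta type at `w`, for `a` and for `a′` (★ p817128), transported to `U(H)(L⁺_v)` (★ p816908)
    have hXI := F0P2iXvSplitModel.areIsomorphicRep_chiCoinv_chiLocalSplittingsD_split L hc1 (by norm_num) e₁ dV hdV hdV0
      (toHeckeCharacter L μ) ((isOscillatorChar_toHeckeCharacter_iff μ).mpr hμ) (isUnitary_toHeckeCharacter L μ) a χ.1 hχu χ.2.1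
      v (splitWitness v hs) (splitWitness_spec v hs) hJh hJw _
      (F0P2iGRDSplit.wReading_det_eq_localCharOfCenter L a χ.1 v (splitWitness v hs) (splitWitness_spec v hs))
    have hXI' := F0P2iXvSplitModel.areIsomorphicRep_chiCoinv_chiLocalSplittingsD_split L hc1 (by norm_num) e₁ dV hdV hdV0
      (toHeckeCharacter L μ) ((isOscillatorChar_toHeckeCharacter_iff μ).mpr hμ) (isUnitary_toHeckeCharacter L μ) a' χ.1 hχu χ.2.1
      v (splitWitness v hs) (splitWitness_spec v hs) hJh' hJw' _
      (F0P2iGRDSplit.wReading_det_eq_localCharOfCenter L a' χ.1 v (splitWitness v hs) (splitWitness_spec v hs))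
    obtain ⟨Ea⟩ := F0P2iGRDSplitTransport.nonempty_equiv_comp_localLineInl_localCongr_symm L H dV g hg e₁
      (JW (↥(maximalRealSubfield L)) L a) v (splitWitness v hs) (splitWitness_spec v hs) hc1 hHh hHw hJh hJw _ _ hXI
    obtain ⟨Ea'⟩ := F0P2iGRDSplitTransport.nonempty_equiv_comp_localLineInl_localCongr_symm L H dV g hg e₁
      (JW (↥(maximalRealSubfield L)) L a') v (splitWitness v hs) (splitWitness_spec v hs) hc1 hHh hHw hJh' hJw' _ _ hXI'
    -- (1) the local types `τ_a`, `τ_{a′}` of `ω_H(a)`, `ω_H(a′)` on `U(H)(L⁺_v)`: irreducible, and the restrictions are isotypic of them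
    obtain ⟨hτ, hτtop⟩ := F0P2cOmegaLocalType.isLocalTypeAt_rhoAtLine_chi L H e₁ dV hdV hdV0 g hg ιV hιV μ hμ a χ v
    obtain ⟨hτ', hτtop'⟩ := F0P2cOmegaLocalType.isLocalTypeAt_rhoAtLine_chi L H e₁ dV hdV hdV0 g hg ιV hιV μ hμ a' χ v
    have hirr := F0P2cStubCI.rhoAtLine_chi_isIrreducible L H e₁ dV hdV hdV0 g hg ιV hιV μ hμ a χ
    have hirr' := F0P2cStubCI.rhoAtLine_chi_isIrreducible L H e₁ dV hdV hdV0 g hg ιV hιV μ hμ a' χ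
    have hsm := (F0P2cStubCI.rhoAtLine_chi_isAdmissible L H e₁ dV hdV hdV0 g hg ιV hιV μ hμ a χ).isSmooth
    have hsm' := (F0P2cStubCI.rhoAtLine_chi_isAdmissible L H e₁ dV hdV hdV0 g hg ιV hιV μ hμ a' χ).isSmooth
    obtain ⟨c₀, hc₀⟩ := F0P3FinRepConstituentsExist.exists_isConstituentOf_comp_inclPlace hirr hsm v
    obtain ⟨c₀', hc₀'⟩ := F0P3FinRepConstituentsExist.exists_isConstituentOf_comp_inclPlace hirr' hsm' v
    obtain ⟨r, rfl⟩ := IrrClass.mk_surjective c₀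
    obtain ⟨r', rfl⟩ := IrrClass.mk_surjective c₀'
    -- `r.ρ ≃ τ_a`, `r′.ρ ≃ τ_{a′}` (constituents of an isotypic representation are constituents of the type; the type is irreducible)
    have hcτ := isConstituentOf_of_isotypicComponent_eq_top hτtop hc₀
    have hcτ' := isConstituentOf_of_isotypicComponent_eq_top hτtop' hc₀'
    obtain ⟨er⟩ := hcτ.nonempty_equiv_of_isIrreducible
    obtain ⟨er'⟩ := hcτ'.nonempty_equiv_of_isIrreducible
    -- `c₀ = c₀′`
    have hcc : IrrClass.mk r = IrrClass.mk r' := IrrClass.mk_eq_mk_of_equiv (((er.trans Ea).trans Ea'.symm).trans er'.symm)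
    -- (3) the common class in D6's currency
    have hP : (IrrClass.comap (localPiEquiv L (IsCMField.complexConj L) 3 H v)
        (IrrClass.comap (localPiEquiv L (IsCMField.complexConj L) 3 H v).symm (IrrClass.mk r))).IsConstituentOf
        (P.finRep.smoothPart.toRepresentation.comp (inclPlace (↥(maximalRealSubfield L)) L (IsCMField.complexConj L) 3 H v)) := by
      rw [IrrClass.comap_comap_symm]
      exact F0P3FinRepConstituentsExist.isConstituentOf_finRepSmooth_comp_of_hasFinComponent P hsm hfin hc₀
    have hP' : (IrrClass.comap (localPiEquiv L (IsCMField.complexConj L) 3 H v)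
        (IrrClass.comap (localPiEquiv L (IsCMField.complexConj L) 3 H v).symm (IrrClass.mk r))).IsConstituentOf
        (P'.finRep.smoothPart.toRepresentation.comp (inclPlace (↥(maximalRealSubfield L)) L (IsCMField.complexConj L) 3 H v)) := by
      rw [IrrClass.comap_comap_symm, hcc]
      exact F0P3FinRepConstituentsExist.isConstituentOf_finRepSmooth_comp_of_hasFinComponent P' hsm' hfin' hc₀'
    obtain ⟨Pv, hPv, hLC⟩ := hmem
    obtain ⟨Pv', hPv', hLC'⟩ := hmem'
    have hm := hLC v _ hP
    have hm' := hLC' v _ hP'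
    rw [hPv.eq_cmSplitPacket v hs] at hm
    rw [hPv'.eq_cmSplitPacket v hs] at hm'
    exact F0P3XiLocalLabelsOfMemXiFamily.bc_localComponent_eq_of_mem_cmSplitPacket_members hH hHd (splitWitness v hs)
      (splitWitness_spec v hs) ξ ξ' μω hμu hm hm'
  exact hmem'

end Summit.HodgeConjecture.HodgeConjecture.Cruxes.H413.F0P2rFamTransferHolds

end
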